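import Summits.CriticalPhenomena.PercolationContinuityZ3.Theorems.PercNearOneGluingNoHeavyLowerTailThreePointProductFormFibreAntithetic
import HarnessLib

/-!
# The product form `#bad² ≤ #P1·#P2` in the fibre language: THE FLAT-PREIMAGE IDENTITY `#J = #bad + w + w′ + j`
# (Sahi programme, prover prim-sahi-p2 gen 56)

Support file (`--supports stmt-CriticalPhenomena-4575`, helper); continues `…ThreePointProductFormFibreAntithetic` (gen 54) and
`…ThreePointProductFormFibreTwoTerminal` (gen 55, the count `w`).  Standard axioms, no sorries, no named facts, no definitions.
Memo `run/shared/lean/prim/prim-sahi/FROM-prim-sahi-p2-gen56-*.md` §1 and PROOF-E3 §66.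

With `R z x y` = open connection in the labelled multigraph `(V, α, ends)` at `z : α → Bool` and `♭z = clusterFlip ends a z̄` the flat of the
apex `a` (complement every label touching the open cluster of `a`), the five TYPES of a configuration are `J = {a ↔ s, a ↔ c}`,
`P1 = {a ↔ s, a ↮ c}`, `P2 = {a ↔ c, a ↮ s}`, `P3 = {a ↮ s, a ↮ c, s ↔ c}`, `S0 = {a ↮ s, a ↮ c, s ↮ c}`; `bad = {z ∈ S0 : s ↔ c in ♭z}`,
`w = #{z ∈ P1 : s ↔ c in ♭z}` (the count of the terminal-network reduction R3, gen 55), `w′ = #{z ∈ P2 : s ↔ c in ♭z}`, `j = #{z ∈ J : s ↔ c in ♭z}`.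
* `card_filter_flat_eq` [this work] — ♭ is a bijection of the configurations: `#{z : Y (♭z)} = #{w : Y w}` for every class `Y`
  (`card_filter_flat_eq_card_filter_compl` with the trivial apex class).
* `card_conn_eq_card_joined_add_card_sep` [folklore] — `#{s ↔ c} = #J + #P3`.
* **`card_joined_eq_card_bad_add_flat_counts`** [this work] — THE FLAT-PREIMAGE IDENTITY: `#J = #bad + w + w′ + j`.
  Proof: the ♭-preimage of `{s ↔ c}` has `#{s ↔ c} = #P3 + #J` elements and splits by type into `bad ⊔ (w-set) ⊔ (w′-set) ⊔ (j-set) ⊔ P3`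
  — ALL of `P3`, because an `s–c` connection avoiding the apex cluster survives the flat (`reachable_flat_of_reachable`).
* Corollaries [this work]: `card_bad_add_w_add_w'_le_card_joined` (`#bad + w + w′ ≤ #J`), and the two LINEAR inequalities of the gen-55 memo
  §0(5), there found with 0 exceptions in 251 610 876 instances and listed as open: **(S5)** `w_le_card_joined` (`w ≤ #J`) and
  **(S4)** `card_bad_add_w_le_card_conn` (`#bad + w ≤ #{a ↔ c}`) — both immediate from the identity.
[folklore] (bijections preserve counts; finite additivity); [cite: Gladkov2024, Conjecture 10.1 (p. 18), arXiv:2408.08457] for CONJECTURE (P) served.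
-/

namespace Summit.CriticalPhenomena.PercolationContinuityZ3.Theorems.ProductFormFibre

open Finset Literature.Probability.Percolation
open Summit.CriticalPhenomena.PercolationContinuityZ3.Theorems.ThreePointCPIClusterSwap (clusterFlip)

variable {V α : Type*}

section FlatPreimage

variable (ends : α → Sym2 V) (a s c : V) [Fintype α] [DecidableEq α]

/-- **♭ is a bijection of the configurations**: for every class `Y`, `#{z : Y (♭z)} = #{w : Y w}`. [this work] -/
theorem card_filter_flat_eq (Y : (α → Bool) → Prop) [DecidablePred Y] :
    (univ.filter fun z : α → Bool => Y (clusterFlip ends a fun l => !z l)).card =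
    (univ.filter fun w : α → Bool => Y w).card := by
  have h := card_filter_flat_eq_card_filter_compl ends a (fun _ => True) Y (fun _ _ _ => Iff.rfl)
  have h1 : (univ.filter fun z : α → Bool => True ∧ Y (clusterFlip ends a fun l => !z l)) =
      (univ.filter fun z : α → Bool => Y (clusterFlip ends a fun l => !z l)) := by
    ext z; simp only [Finset.mem_filter, Finset.mem_univ, true_and]
  have h2 : (univ.filter fun w : α → Bool => Y w ∧ True) = (univ.filter fun w : α → Bool => Y w) := by
    ext z; simp only [Finset.mem_filter, Finset.mem_univ, true_and, and_true]
  rw [h1, h2] at h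
  exact h

open Classical in
/-- **`#{s ↔ c} = #J + #P3`**: a configuration joining `s` to `c` either joins the apex to both terminals or to neither. [folklore] -/
theorem card_conn_eq_card_joined_add_card_sep :
    (univ.filter fun w : α → Bool => (openGraph (labelledOpen ends w)).Reachable s c).card =
    (univ.filter fun w : α → Bool =>
        (openGraph (labelledOpen ends w)).Reachable a s ∧ (openGraph (labelledOpen ends w)).Reachable a c).card +
    (univ.filter fun w : α → Bool =>
        ¬ (openGraph (labelledOpen ends w)).Reachable a s ∧ ¬ (openGraph (labelledOpen ends w)).Reachable a c ∧
          (openGraph (labelledOpen ends w)).Reachable s c).card := by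
  rw [← Finset.card_filter_add_card_filter_not
    (s := univ.filter fun w : α → Bool => (openGraph (labelledOpen ends w)).Reachable s c)
    (fun w : α → Bool => (openGraph (labelledOpen ends w)).Reachable a s)]
  congr 1
  · congr 1
    ext w
    simp only [Finset.mem_filter, Finset.mem_univ, true_and]
    constructor
    · rintro ⟨hsc, has⟩
      exact ⟨has, has.trans hsc⟩
    · rintro ⟨has, hac⟩
      exact ⟨has.symm.trans hac, has⟩
  · congr 1
    ext w
    simp only [Finset.mem_filter, Finset.mem_univ, true_and]
    constructor
    · rintro ⟨hsc, has⟩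
      exact ⟨has, fun hac => has (hac.trans hsc.symm), hsc⟩
    · rintro ⟨has, -, hsc⟩
      exact ⟨hsc, has⟩

open Classical in
/-- **THE FLAT-PREIMAGE IDENTITY `#J = #bad + w + w′ + j`.**  For every finite labelled multigraph and all `a s c`:
`#{a ↔ s, a ↔ c} = #bad + #{z ∈ P1 : s ↔ c in ♭z} + #{z ∈ P2 : s ↔ c in ♭z} + #{z ∈ J : s ↔ c in ♭z}`
(`bad = {a ↮ s, a ↮ c, s ↮ c in z, s ↔ c in ♭z}`, `P1 = {a ↔ s, a ↮ c}`, `P2 = {a ↔ c, a ↮ s}`, `J = {a ↔ s, a ↔ c}`).  The ♭-preimage of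
`{s ↔ c}` (of size `#P3 + #J`, ♭ being a bijection) splits by type into these four sets and ALL of `P3 = {a ↮ s, a ↮ c, s ↔ c}`. [this work] -/
theorem card_joined_eq_card_bad_add_flat_counts :
    (univ.filter fun z : α → Bool =>
        (openGraph (labelledOpen ends z)).Reachable a s ∧ (openGraph (labelledOpen ends z)).Reachable a c).card =
    (univ.filter fun z : α → Bool =>
        (¬ (openGraph (labelledOpen ends z)).Reachable a s ∧ ¬ (openGraph (labelledOpen ends z)).Reachable a c ∧
          ¬ (openGraph (labelledOpen ends z)).Reachable s c) ∧
        (openGraph (labelledOpen ends (clusterFlip ends a fun l => !z l))).Reachable s c).card +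
    (univ.filter fun z : α → Bool =>
        ((openGraph (labelledOpen ends z)).Reachable a s ∧ ¬ (openGraph (labelledOpen ends z)).Reachable a c) ∧
        (openGraph (labelledOpen ends (clusterFlip ends a fun l => !z l))).Reachable s c).card +
    (univ.filter fun z : α → Bool =>
        ((openGraph (labelledOpen ends z)).Reachable a c ∧ ¬ (openGraph (labelledOpen ends z)).Reachable a s) ∧
        (openGraph (labelledOpen ends (clusterFlip ends a fun l => !z l))).Reachable s c).card +
    (univ.filter fun z : α → Bool =>
        ((openGraph (labelledOpen ends z)).Reachable a s ∧ (openGraph (labelledOpen ends z)).Reachable a c) ∧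
        (openGraph (labelledOpen ends (clusterFlip ends a fun l => !z l))).Reachable s c).card := by
  -- total size of the ♭-preimage of `{s ↔ c}`
  have htot := card_filter_flat_eq ends a (fun w : α → Bool => (openGraph (labelledOpen ends w)).Reachable s c)
  rw [card_conn_eq_card_joined_add_card_sep ends a s c] at htot
  -- split the preimage by `a ↔ s`
  have hA := Finset.card_filter_add_card_filter_not
    (s := univ.filter fun z : α → Bool =>
      (openGraph (labelledOpen ends (clusterFlip ends a fun l => !z l))).Reachable s c)
    (fun z : α → Bool => (openGraph (labelledOpen ends z)).Reachable a s)
  -- split the `a ↔ s` part by `a ↔ c`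
  have hB := Finset.card_filter_add_card_filter_not
    (s := (univ.filter fun z : α → Bool =>
      (openGraph (labelledOpen ends (clusterFlip ends a fun l => !z l))).Reachable s c).filter
      fun z : α → Bool => (openGraph (labelledOpen ends z)).Reachable a s)
    (fun z : α → Bool => (openGraph (labelledOpen ends z)).Reachable a c)
  -- split the `a ↮ s` part by `a ↔ c`
  have hC := Finset.card_filter_add_card_filter_not
    (s := (univ.filter fun z : α → Bool =>
      (openGraph (labelledOpen ends (clusterFlip ends a fun l => !z l))).Reachable s c).filter
      fun z : α → Bool => ¬ (openGraph (labelledOpen ends z)).Reachable a s)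
    (fun z : α → Bool => (openGraph (labelledOpen ends z)).Reachable a c)
  -- split the `a ↮ s, a ↮ c` part by `s ↔ c`
  have hD := Finset.card_filter_add_card_filter_not
    (s := ((univ.filter fun z : α → Bool =>
      (openGraph (labelledOpen ends (clusterFlip ends a fun l => !z l))).Reachable s c).filter
      fun z : α → Bool => ¬ (openGraph (labelledOpen ends z)).Reachable a s).filter
      fun z : α → Bool => ¬ (openGraph (labelledOpen ends z)).Reachable a c)
    (fun z : α → Bool => (openGraph (labelledOpen ends z)).Reachable s c)
  -- identify the pieces
  have ej : ((univ.filter fun z : α → Bool =>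
      (openGraph (labelledOpen ends (clusterFlip ends a fun l => !z l))).Reachable s c).filter
      fun z : α → Bool => (openGraph (labelledOpen ends z)).Reachable a s).filter
      (fun z : α → Bool => (openGraph (labelledOpen ends z)).Reachable a c) =
    (univ.filter fun z : α → Bool =>
        ((openGraph (labelledOpen ends z)).Reachable a s ∧ (openGraph (labelledOpen ends z)).Reachable a c) ∧
        (openGraph (labelledOpen ends (clusterFlip ends a fun l => !z l))).Reachable s c) := by
    ext z; simp only [Finset.mem_filter, Finset.mem_univ, true_and]; tauto
  have ew : ((univ.filter fun z : α → Bool =>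
      (openGraph (labelledOpen ends (clusterFlip ends a fun l => !z l))).Reachable s c).filter
      fun z : α → Bool => (openGraph (labelledOpen ends z)).Reachable a s).filter
      (fun z : α → Bool => ¬ (openGraph (labelledOpen ends z)).Reachable a c) =
    (univ.filter fun z : α → Bool =>
        ((openGraph (labelledOpen ends z)).Reachable a s ∧ ¬ (openGraph (labelledOpen ends z)).Reachable a c) ∧
        (openGraph (labelledOpen ends (clusterFlip ends a fun l => !z l))).Reachable s c) := by
    ext z; simp only [Finset.mem_filter, Finset.mem_univ, true_and]; tauto
  have ew' : ((univ.filter fun z : α → Bool =>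
      (openGraph (labelledOpen ends (clusterFlip ends a fun l => !z l))).Reachable s c).filter
      fun z : α → Bool => ¬ (openGraph (labelledOpen ends z)).Reachable a s).filter
      (fun z : α → Bool => (openGraph (labelledOpen ends z)).Reachable a c) =
    (univ.filter fun z : α → Bool =>
        ((openGraph (labelledOpen ends z)).Reachable a c ∧ ¬ (openGraph (labelledOpen ends z)).Reachable a s) ∧
        (openGraph (labelledOpen ends (clusterFlip ends a fun l => !z l))).Reachable s c) := by
    ext z; simp only [Finset.mem_filter, Finset.mem_univ, true_and]; tauto
  have eP3 : (((univ.filter fun z : α → Bool =>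
      (openGraph (labelledOpen ends (clusterFlip ends a fun l => !z l))).Reachable s c).filter
      fun z : α → Bool => ¬ (openGraph (labelledOpen ends z)).Reachable a s).filter
      fun z : α → Bool => ¬ (openGraph (labelledOpen ends z)).Reachable a c).filter
      (fun z : α → Bool => (openGraph (labelledOpen ends z)).Reachable s c) =
    (univ.filter fun w : α → Bool =>
        ¬ (openGraph (labelledOpen ends w)).Reachable a s ∧ ¬ (openGraph (labelledOpen ends w)).Reachable a c ∧
          (openGraph (labelledOpen ends w)).Reachable s c) := by
    ext z
    simp only [Finset.mem_filter, Finset.mem_univ, true_and]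
    constructor
    · rintro ⟨⟨⟨-, has⟩, hac⟩, hsc⟩
      exact ⟨has, hac, hsc⟩
    · rintro ⟨has, hac, hsc⟩
      exact ⟨⟨⟨reachable_flat_of_reachable ends a z has hsc, has⟩, hac⟩, hsc⟩
  have ebad : (((univ.filter fun z : α → Bool =>
      (openGraph (labelledOpen ends (clusterFlip ends a fun l => !z l))).Reachable s c).filter
      fun z : α → Bool => ¬ (openGraph (labelledOpen ends z)).Reachable a s).filter
      fun z : α → Bool => ¬ (openGraph (labelledOpen ends z)).Reachable a c).filter
      (fun z : α → Bool => ¬ (openGraph (labelledOpen ends z)).Reachable s c) =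
    (univ.filter fun z : α → Bool =>
        (¬ (openGraph (labelledOpen ends z)).Reachable a s ∧ ¬ (openGraph (labelledOpen ends z)).Reachable a c ∧
          ¬ (openGraph (labelledOpen ends z)).Reachable s c) ∧
        (openGraph (labelledOpen ends (clusterFlip ends a fun l => !z l))).Reachable s c) := by
    ext z; simp only [Finset.mem_filter, Finset.mem_univ, true_and]; tauto
  rw [ej, ew] at hB
  rw [ew'] at hC
  rw [eP3, ebad] at hD
  omega

open Classical in
/-- **`#bad + w + w′ ≤ #J`.** [this work] -/
theorem card_bad_add_w_add_w'_le_card_joined :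
    (univ.filter fun z : α → Bool =>
        (¬ (openGraph (labelledOpen ends z)).Reachable a s ∧ ¬ (openGraph (labelledOpen ends z)).Reachable a c ∧
          ¬ (openGraph (labelledOpen ends z)).Reachable s c) ∧
        (openGraph (labelledOpen ends (clusterFlip ends a fun l => !z l))).Reachable s c).card +
    (univ.filter fun z : α → Bool =>
        ((openGraph (labelledOpen ends z)).Reachable a s ∧ ¬ (openGraph (labelledOpen ends z)).Reachable a c) ∧
        (openGraph (labelledOpen ends (clusterFlip ends a fun l => !z l))).Reachable s c).card +
    (univ.filter fun z : α → Bool =>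
        ((openGraph (labelledOpen ends z)).Reachable a c ∧ ¬ (openGraph (labelledOpen ends z)).Reachable a s) ∧
        (openGraph (labelledOpen ends (clusterFlip ends a fun l => !z l))).Reachable s c).card ≤
    (univ.filter fun z : α → Bool =>
        (openGraph (labelledOpen ends z)).Reachable a s ∧ (openGraph (labelledOpen ends z)).Reachable a c).card := by
  have h := card_joined_eq_card_bad_add_flat_counts ends a s c
  omega

open Classical in
/-- **(S5) `w ≤ #J`**: the configurations of type `P1 = {a ↔ s, a ↮ c}` whose flat joins `s` to `c` are at most as many as the
configurations joining the apex to both terminals (gen-55 memo §0(5), there conjectured; immediate from the flat-preimage identity). [this work] -/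
theorem w_le_card_joined :
    (univ.filter fun z : α → Bool =>
        ((openGraph (labelledOpen ends z)).Reachable a s ∧ ¬ (openGraph (labelledOpen ends z)).Reachable a c) ∧
        (openGraph (labelledOpen ends (clusterFlip ends a fun l => !z l))).Reachable s c).card ≤
    (univ.filter fun z : α → Bool =>
        (openGraph (labelledOpen ends z)).Reachable a s ∧ (openGraph (labelledOpen ends z)).Reachable a c).card := by
  have h := card_joined_eq_card_bad_add_flat_counts ends a s c
  omega

open Classical in
/-- **(S4) `#bad + w ≤ #{a ↔ c}`** (gen-55 memo §0(5), there conjectured): indeed `#bad + w + w′ ≤ #J ≤ #{a ↔ c}`. [this work] -/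
theorem card_bad_add_w_le_card_conn :
    (univ.filter fun z : α → Bool =>
        (¬ (openGraph (labelledOpen ends z)).Reachable a s ∧ ¬ (openGraph (labelledOpen ends z)).Reachable a c ∧
          ¬ (openGraph (labelledOpen ends z)).Reachable s c) ∧
        (openGraph (labelledOpen ends (clusterFlip ends a fun l => !z l))).Reachable s c).card +
    (univ.filter fun z : α → Bool =>
        ((openGraph (labelledOpen ends z)).Reachable a s ∧ ¬ (openGraph (labelledOpen ends z)).Reachable a c) ∧
        (openGraph (labelledOpen ends (clusterFlip ends a fun l => !z l))).Reachable s c).card ≤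
    (univ.filter fun z : α → Bool => (openGraph (labelledOpen ends z)).Reachable a c).card := by
  have h := card_joined_eq_card_bad_add_flat_counts ends a s c
  have hJ : (univ.filter fun z : α → Bool =>
        (openGraph (labelledOpen ends z)).Reachable a s ∧ (openGraph (labelledOpen ends z)).Reachable a c).card ≤
      (univ.filter fun z : α → Bool => (openGraph (labelledOpen ends z)).Reachable a c).card := by
    refine Finset.card_le_card ?_
    intro z hz
    rw [Finset.mem_filter] at hz ⊢
    exact ⟨hz.1, hz.2.2⟩
  omega

end FlatPreimage

end Summit.CriticalPhenomena.PercolationContinuityZ3.Theorems.ProductFormFibre
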